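import Summits.ValiantsHypothesis.ValiantsHypothesis.Theorems.ValuativeGCTValuativeBoundNegativeLoadBearing

/-!
# `ValuativeGCT.ValuativeBound` (stmt-ValiantsHypothesis-12625) — negative side, 3/5: ROWS, not columns

LEMMA R (`apply_eq_zero_of_mem_borelSemiInvariants_lastWeight`): a `B`-semi-invariant of weight
`(0,…,0,-n)` involves only the last-row variables `X (iLast, ·)` (torus `diag(1,…,1 | 2⁻¹)`).
Consequence: the crux with COLUMNS for ROWS in `L_U` is FALSE — `valuativeBound_false_with_columns`
(`m = 2`, `U = ℂ·E₁₁`, `r = 1`, `δ = 1`, `λ = (2)`).  `det_m(xA) = det(∑_j x_j · row_j A)` spans the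
ROWS of `A` (tree `linSubst_X`).  Elementary; no new facts.
-/

noncomputable section

open MvPolynomial

namespace Summit.ValiantsHypothesis.Theorems.ValuativeBoundNegative

open Literature.NumberTheory.DiophantineGeometry Literature.Computability.AlgebraicComplexity

section TorusSupport

variable {m : ℕ} [NeZero m]

/-- Coefficients under a diagonal substitution (the tree's `coeff_linSubst_diagonal`, restated
without the `LinearOrder` hypothesis so that it applies to the variable set `MatIdx m × MatIdx m`). [folklore] -/
theorem coeff_linSubst_diagonal' {σ : Type*} [Fintype σ] [DecidableEq σ] (d : σ → ℂ)
    (v : MvPolynomial σ ℂ) (e : σ →₀ ℕ) :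
    coeff e (linSubst σ ℂ (Matrix.diagonal d) v) = (∏ i, d i ^ e i) * coeff e v := by
  conv_lhs => rw [v.as_sum, map_sum]
  rw [coeff_sum]
  simp only [linSubst_diagonal_monomial, coeff_smul, coeff_monomial, smul_eq_mul]
  rw [Finset.sum_eq_single e]
  · rw [if_pos rfl, Finsupp.prod_fintype _ _ (fun i => pow_zero (d i))]
  · intro e' _ hne
    rw [if_neg hne, mul_zero]
  · intro he
    rw [if_pos rfl, notMem_support_iff.mp he, mul_zero]

omit [NeZero m] in
/-- The Borel substitution at a torus element `diag(x)` is the diagonal substitution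
`X (j,i) ↦ (x j)⁻¹ X (j,i)`. [folklore] -/
theorem borelFun_torusElt (x : MatIdx m → ℂ) (hx : ∀ j, x j ≠ 0) :
    (fun p : MatIdx m × MatIdx m => ∑ l : MatIdx m,
      (((torusElt x hx)⁻¹ : GL (MatIdx m) ℂ) : Matrix (MatIdx m) (MatIdx m) ℂ) p.1 l •
        (X (l, p.2) : MvPolynomial (MatIdx m × MatIdx m) ℂ)) =
      fun p => (x p.1)⁻¹ • X p := by
  funext p
  rw [coe_inv_torusElt, Finset.sum_eq_single p.1 (fun l _ hl => by
    rw [Matrix.diagonal_apply_ne _ (Ne.symm hl), zero_smul]) (fun h => absurd (Finset.mem_univ _) h),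
    Matrix.diagonal_apply_eq]

/-- A diagonal rescaling of the variables is a `linSubst` by a diagonal matrix. [folklore] -/
theorem aeval_smul_X_eq_linSubst_diagonal {σ : Type*} [Fintype σ] [DecidableEq σ] (D : σ → ℂ) :
    (MvPolynomial.aeval fun p : σ => D p • (X p : MvPolynomial σ ℂ)) =
      linSubst σ ℂ (Matrix.diagonal D) := by
  apply MvPolynomial.algHom_ext
  intro p
  rw [aeval_X, linSubst_X, Finset.sum_eq_single p (fun j _ hj => by
    rw [Matrix.diagonal_apply_ne _ hj, zero_smul]) (fun h => absurd (Finset.mem_univ p) h),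
    Matrix.diagonal_apply_eq]

/-- **LEMMA R (torus support).** A `B`-semi-invariant of weight `(0,…,0,-n)` involves only the
variables of the LAST ROW `X (iLast, ·)`: test the torus element `diag(1,…,1 | 2⁻¹ off the last
index)`, whose character value is `1`, and compare coefficients (`2^N = 1 ⇒ N = 0`). [folklore] -/
theorem apply_eq_zero_of_mem_borelSemiInvariants_lastWeight {n : ℕ}
    {G : MvPolynomial (MatIdx m × MatIdx m) ℂ} (hB : G ∈ borelSemiInvariants m (lastWeight m n))
    {e : MatIdx m × MatIdx m →₀ ℕ} (he : e ∈ G.support) {p : MatIdx m × MatIdx m}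
    (hp : p.1 ≠ iLast m) : e p = 0 := by
  classical
  set x : MatIdx m → ℂ := fun j => if j = iLast m then 1 else 2⁻¹ with hxdef
  have hx : ∀ j, x j ≠ 0 := fun j => by
    by_cases hj : j = iLast m <;> simp [hxdef, hj]
  have h := (mem_borelSemiInvariants_iff.mp hB) (torusElt x hx)
    (isDiagonalGL_torusElt x hx).isUpperTriangular
  rw [borelFun_torusElt x hx, weightChar_lastWeight, coe_torusElt, Matrix.diagonal_apply_eq] at h
  have hx1 : x (iLast m) = 1 := by simp [hxdef]
  rw [hx1, inv_one, one_pow, one_smul, aeval_smul_X_eq_linSubst_diagonal] at h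
  -- compare the coefficient of `e`
  have hc := congrArg (coeff e) h
  rw [coeff_linSubst_diagonal'] at hc
  have hce : coeff e G ≠ 0 := mem_support_iff.mp he
  have hprod : (∏ q : MatIdx m × MatIdx m, (x q.1)⁻¹ ^ e q) = 1 := by
    have := mul_right_cancel₀ hce (hc.trans (one_mul _).symm)
    exact this
  -- the product is `2 ^ (∑ over q with q.1 ≠ iLast)`
  have hsplit : (∏ q : MatIdx m × MatIdx m, (x q.1)⁻¹ ^ e q) =
      2 ^ (∑ q ∈ Finset.univ.filter (fun q : MatIdx m × MatIdx m => q.1 ≠ iLast m), e q) := by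
    rw [← Finset.prod_pow_eq_pow_sum,
      ← Finset.prod_filter_mul_prod_filter_not Finset.univ (fun q : MatIdx m × MatIdx m => q.1 ≠ iLast m)]
    rw [Finset.prod_eq_one (s := Finset.univ.filter fun q : MatIdx m × MatIdx m => ¬ q.1 ≠ iLast m)
      (fun q hq => by
        simp only [Finset.mem_filter, Finset.mem_univ, true_and, not_not] at hq
        simp [hxdef, hq]), mul_one]
    refine Finset.prod_congr rfl fun q hq => ?_
    simp only [Finset.mem_filter, Finset.mem_univ, true_and] at hq
    simp [hxdef, hq]
  rw [hsplit] at hprod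
  have hN : (∑ q ∈ Finset.univ.filter (fun q : MatIdx m × MatIdx m => q.1 ≠ iLast m), e q) = 0 := by
    by_contra hN
    exact two_pow_ne_two_pow hN (by rw [hprod, pow_zero])
  exact (Finset.sum_eq_zero_iff.mp hN) p (by simp [hp])

end TorusSupport

section Columns

/-- The line `U = ℂ · e_last ⊂ ℂ^{MatIdx 2}` (the matrix unit `E₁₁`), a rank-`≤ 1` space. [folklore] -/
def lineLast : Submodule ℂ (MatIdx 2 → ℂ) :=
  ℂ ∙ (Pi.single (iLast 2) (1 : ℂ))

/-- Every element of `ℂ·E₁₁` has rank `≤ 1`. [folklore] -/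
theorem rank_le_one_of_mem_lineLast {u : MatIdx 2 → ℂ} (hu : u ∈ lineLast) :
    (Matrix.of fun a b : Fin 2 => u (toLex (a, b))).rank ≤ 1 := by
  classical
  obtain ⟨c, rfl⟩ := Submodule.mem_span_singleton.mp hu
  have hmat : (Matrix.of fun a b : Fin 2 => (c • (Pi.single (iLast 2) (1 : ℂ) : MatIdx 2 → ℂ)) (toLex (a, b))) =
      Matrix.vecMulVec (fun a : Fin 2 => if a = 1 then c else 0)
        (fun b : Fin 2 => if b = 1 then (1 : ℂ) else 0) := by
    ext a b
    simp only [Matrix.of_apply, Pi.smul_apply, Pi.single_apply, Matrix.vecMulVec_apply, iLast,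
      smul_eq_mul, EmbeddingLike.apply_eq_iff_eq, Prod.mk.injEq]
    have h1 : (⟨2 - 1, Nat.sub_one_lt (NeZero.ne 2)⟩ : Fin 2) = 1 := rfl
    simp only [h1]
    by_cases ha : a = 1 <;> by_cases hb : b = 1 <;> simp [ha, hb]
  rw [hmat]
  exact Matrix.rank_vecMulVec_le _ _

/-- Zeroing every row but the last lands in the column locus of `ℂ·e_last`. [folklore] -/
theorem mem_colLocus_lineLast (z : MatIdx 2 × MatIdx 2 → ℂ) :
    (fun p : MatIdx 2 × MatIdx 2 => if p.1 = iLast 2 then z p else 0) ∈ colLocus 2 lineLast := by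
  intro i
  have : (fun j : MatIdx 2 => if ((j, i) : MatIdx 2 × MatIdx 2).1 = iLast 2 then z (j, i) else 0) =
      z (iLast 2, i) • (Pi.single (iLast 2) (1 : ℂ) : MatIdx 2 → ℂ) := by
    funext j
    by_cases hj : j = iLast 2
    · subst hj; simp
    · simp [hj]
  rw [this]
  exact Submodule.smul_mem _ _ (Submodule.mem_span_singleton_self _)

/-- **The column truncation of weight `(2)*` at `U = ℂ·e_last` is ZERO**: a semi-invariant of
weight `(0,0,0,-2)` lives on the last row (Lemma R), and a last-row polynomial vanishing on
`{only the last row is free}` vanishes everywhere. [folklore] -/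
theorem truncation_colLocus_lineLast_eq_bot (t : ℕ) (ht : t ≠ 0) (n N : ℕ) :
    truncation 2 (colLocus 2 lineLast) t n (lastWeight 2 N) = ⊥ := by
  classical
  rw [eq_bot_iff]
  intro G hG
  rw [mem_truncation_iff] at hG
  obtain ⟨-, hV, -, hB⟩ := hG
  have hV1 : G ∈ MvPolynomial.vanishingIdeal ℂ (colLocus 2 lineLast) :=
    Ideal.pow_le_self ht hV
  rw [MvPolynomial.mem_vanishingIdeal_iff] at hV1
  refine (Submodule.mem_bot ℂ).mpr (MvPolynomial.funext fun z => ?_)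
  rw [map_zero]
  set y : MatIdx 2 × MatIdx 2 → ℂ := fun p => if p.1 = iLast 2 then z p else 0 with hy
  have h0 : MvPolynomial.eval y G = 0 := by
    rw [← MvPolynomial.coe_aeval_eq_eval]
    exact hV1 y (mem_colLocus_lineLast z)
  rw [← h0, MvPolynomial.eval_eq', MvPolynomial.eval_eq']
  refine Finset.sum_congr rfl fun e he => ?_
  congr 1
  refine Finset.prod_congr rfl fun p _ => ?_
  by_cases hp : p.1 = iLast 2
  · simp [hy, hp]
  · rw [apply_eq_zero_of_mem_borelSemiInvariants_lastWeight hB he hp, pow_zero, pow_zero]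

/-- **ROWS ARE LOAD-BEARING AT THE CRUX LEVEL (columns variant is FALSE).** Witness `m = 2`,
`U = ℂ·E₁₁` (rank `≤ 1 = r`), `δ = 1`, `λ = (2)`: threshold `1`, `K_2((2)*) ≥ 1`, column
truncation `= 0`.  (Gen-1 had the estimate-level statement `coeffVanishingOrder_false_with_columns`;
this is the crux-level one.  Reason in one line: `det_m(xA) = det(∑_j x_j · row_j(A))` spans the
ROWS of `A` — tree `linSubst_X : X i ↦ ∑ j, A j i • X j`.) [folklore] -/
theorem valuativeBound_false_with_columns :
    ¬ (∀ (m : ℕ) [NeZero m] (U : Submodule ℂ (MatIdx m → ℂ)) (r : ℕ),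
        (∀ u ∈ U, (Matrix.of fun a b : Fin m => u (toLex (a, b))).rank ≤ r) →
        ∀ (δ : ℕ) (lam : Nat.Partition (m * δ)), lam.parts.card ≤ m * m →
          orbitMultiplicity ℂ (detFormLex ℂ m) m (Weight.dualOfPartition (m * m) lam).toMatIdx ≤
            Module.finrank ℂ (truncation m (colLocus m U) (δ * (m - r)) (m * δ)
              (Weight.dualOfPartition (m * m) lam).toMatIdx)) := by
  intro h
  have h1 := h 2 lineLast 1 (fun u hu => rank_le_one_of_mem_lineLast hu) 1
    (Nat.Partition.indiscrete (2 * 1)) (card_parts_indiscrete_le 2 _)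
  rw [toMatIdx_dualOfPartition_indiscrete 2 1,
    truncation_colLocus_lineLast_eq_bot (1 * (2 - 1)) (by norm_num) (2 * 1) (2 * 1), finrank_bot] at h1
  exact Nat.not_succ_le_zero _ (le_trans (one_le_orbitMultiplicity_det_lastWeight 2 1) h1)

end Columns

end Summit.ValiantsHypothesis.Theorems.ValuativeBoundNegative

end
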